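import Summits.BirchSwinnertonDyer.BirchSwinnertonDyer.Theorems.ResidualThetaTransportAtTwoSignedMuVanishingAtTwoPlusMultOneDictionary
import HarnessLib

/-!
# Route `ResidualThetaTransportAtTwo`, crux Kμ⁺ `SignedMuVanishingAtTwoPlus` (stmt-BirchSwinnertonDyer-20689), line
# `birth`, stub `stub_flatMuZeroAtTwo`: the (MO⁺) DICTIONARY, part 1b — `hMO` of `…OldClassCongruence.flatAtTwo_of_multOne`
# from (I) «at most four mod-2 eigencharacters» ∧ (II) «`Ω⁺_f/2 ∉ Λ_f`», and FLAT at `(W, f)` with `hMO` so replaced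

Cell `bsd-wall`, width seat `bsd-wall-rtt-p4-w2` (g4). THEOREMS ONLY (no `def`, no named fact, no `sorry`); helper
`--supports` the crux; closes nothing. Sequel of `…MultOneDictionary` (the abstract count `eq_of_card_le_four_of_exists_not_even`
and the odd eigencharacter `exists_eigenChar_not_even_of_half_plusPeriod_not_mem`). BSD is not proved by this; every hypothesis
is a hypothesis.

* `multOnePlus_of_card_le_four` — for a rational normalised newform `f`: (I) every finite set of additive maps
  `Γ₀(N) → ZMod 2` through the period functional that are Hecke eigencharacters with `a_p(f) mod 2` at all primes has `≤ 4`
  elements, and (II) `Ω⁺_f/2 ∉ Λ_f`, IMPLY the hypothesis `hMO` of `…OldClassCongruence` verbatim (two such maps that are even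
  under `γ ↦ εγε` and non-zero coincide).
* `flatAtTwo_of_card_le_four` — `…OldClassCongruence.flatAtTwo_of_multOne` with `hMO` replaced by (I) ∧ (II).
(I) is what mod-2 multiplicity one `dim J₀(N)[𝔪_f] = 2` (`buzzard2000_multiplicityOne_gamma0`) gives through a Hecke-self-adjoint
perfect pairing on `H₁(X₀(N); ℤ)` (parts 2–3 of the dictionary, not here); (II) is «`E_f(ℝ)` connected» (rhombic period
lattice), replacing the Galois-side «complex conjugation is a transposition on `J₀(N)[𝔪] ≅ W[2]`».

References: K. Buzzard, Math. Res. Lett. 7 (2000) Prop. 2.4 [Buzzard2000]; J. E. Cremona, *Algorithms for modular elliptic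
curves* (1997) §2.8 [CremonaAlgorithms1997]; R. Pollack, Duke Math. J. 118 (2003) [Pollack2003]; M. Emerton, R. Pollack,
T. Weston, Invent. Math. 163 (2006) §4.4 [EmertonPollackWeston2006].
-/

set_option autoImplicit false
set_option linter.dupNamespace false

noncomputable section

open scoped Classical MatrixGroups ModularForm

open CongruenceSubgroup WeierstrassCurve Literature.NumberTheory.EllipticCurves
  Literature.NumberTheory.EllipticCurves.ModularForms Literature.NumberTheory.EllipticCurves.Rank1Residual
  Literature.NumberTheory.IwasawaTheory Summit.BirchSwinnertonDyer.Rank1Residual.Supersingular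
  Summit.BirchSwinnertonDyer.BirchSwinnertonDyer.Theses.ResidualThetaTransportAtTwo

namespace Summit.BirchSwinnertonDyer.BirchSwinnertonDyer.Theorems.SignedMuAtTwo

namespace MultOneDictionary

/-! ## §2. (MO⁺) from (I) «at most four eigencharacters» and (II) «`Ω⁺_f/2` is not a period» -/

section MultOne

variable {N : ℕ} [NeZero N] (f : CuspForm (Gamma0 N) 2)

/-- **The (MO⁺) dictionary, character side.** For a normalised newform `f` of level `N` with rational coefficients and
eigenvalues `A p = a_p(f)`: IF (I) every finite set of additive maps `Γ₀(N) → ZMod 2` through the period functional that are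
Hecke eigencharacters with eigenvalues `A p mod 2` at all primes has at most `4` elements («`dim (Λ̄/𝔪_fΛ̄)^* ≤ 2`», the
character form of mod-2 multiplicity one) AND (II) `Ω⁺_f/2 ∉ Λ_f`, THEN any two such maps that are moreover EVEN under
`γ ↦ εγε` and non-zero coincide — literally the hypothesis `hMO` of `…OldClassCongruence.exists_odd_of_multOne` /
`flatAtTwo_of_multOne`. [cite: Buzzard2000, Prop. 2.4] [cite: CremonaAlgorithms1997, §2.8] -/
theorem multOnePlus_of_card_le_four (hf : IsNewform0 f) (hQ : coeffField f = ⊥)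
    (A : ℕ → ℤ) (hA : ∀ p : ℕ, p.Prime → cuspCoeff f p = (A p : ℂ))
    (hfour : ∀ s : Finset (Gamma0 N → ZMod 2),
      (∀ χ ∈ s, (∀ γ γ' : Gamma0 N, χ (γ * γ') = χ γ + χ γ') ∧
        (∀ γ γ' : Gamma0 N, periodFunctional N γ = periodFunctional N γ' → χ γ = χ γ') ∧
        (∀ (p : ℕ) (hp : p.Prime) (γ σ : Gamma0 N),
          periodFunctional N σ = (haveI : NeZero p := ⟨hp.ne_zero⟩; heckeT (Gamma0 N) 2 p).dualMap (periodFunctional N γ) →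
          χ σ = ((A p : ℤ) : ZMod 2) * χ γ)) → s.card ≤ 4)
    (hrh : ((plusPeriod f / 2 : ℝ) : ℂ) ∉ periodLattice f) :
    ∀ χ₁ χ₂ : Gamma0 N → ZMod 2,
      (∀ γ γ' : Gamma0 N, χ₁ (γ * γ') = χ₁ γ + χ₁ γ') →
      (∀ γ γ' : Gamma0 N, periodFunctional N γ = periodFunctional N γ' → χ₁ γ = χ₁ γ') →
      (∀ γ γ' : Gamma0 N, (γ' : SL(2, ℤ)) 0 0 = (γ : SL(2, ℤ)) 0 0 →
        (γ' : SL(2, ℤ)) 1 0 = -((γ : SL(2, ℤ)) 1 0) → χ₁ γ' = χ₁ γ) →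
      (∀ (p : ℕ) (hp : p.Prime) (γ σ : Gamma0 N),
        periodFunctional N σ = (haveI : NeZero p := ⟨hp.ne_zero⟩; heckeT (Gamma0 N) 2 p).dualMap (periodFunctional N γ) →
        χ₁ σ = ((A p : ℤ) : ZMod 2) * χ₁ γ) →
      (∀ γ γ' : Gamma0 N, χ₂ (γ * γ') = χ₂ γ + χ₂ γ') →
      (∀ γ γ' : Gamma0 N, periodFunctional N γ = periodFunctional N γ' → χ₂ γ = χ₂ γ') →
      (∀ γ γ' : Gamma0 N, (γ' : SL(2, ℤ)) 0 0 = (γ : SL(2, ℤ)) 0 0 →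
        (γ' : SL(2, ℤ)) 1 0 = -((γ : SL(2, ℤ)) 1 0) → χ₂ γ' = χ₂ γ) →
      (∀ (p : ℕ) (hp : p.Prime) (γ σ : Gamma0 N),
        periodFunctional N σ = (haveI : NeZero p := ⟨hp.ne_zero⟩; heckeT (Gamma0 N) 2 p).dualMap (periodFunctional N γ) →
        χ₂ σ = ((A p : ℤ) : ZMod 2) * χ₂ γ) →
      (∃ γ, χ₁ γ ≠ 0) → (∃ γ, χ₂ γ ≠ 0) → ∀ γ, χ₁ γ = χ₂ γ := by
  intro χ₁ χ₂ a₁ b₁ e₁ c₁ a₂ b₂ e₂ c₂ n₁ n₂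
  -- the two properties `P` (structural clauses) and `E` (evenness)
  let P : (Gamma0 N → ZMod 2) → Prop := fun χ ↦
    (∀ γ γ' : Gamma0 N, χ (γ * γ') = χ γ + χ γ') ∧
      (∀ γ γ' : Gamma0 N, periodFunctional N γ = periodFunctional N γ' → χ γ = χ γ') ∧
      (∀ (p : ℕ) (hp : p.Prime) (γ σ : Gamma0 N),
        periodFunctional N σ = (haveI : NeZero p := ⟨hp.ne_zero⟩; heckeT (Gamma0 N) 2 p).dualMap (periodFunctional N γ) →
        χ σ = ((A p : ℤ) : ZMod 2) * χ γ)
  let E : (Gamma0 N → ZMod 2) → Prop := fun χ ↦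
    ∀ γ γ' : Gamma0 N, (γ' : SL(2, ℤ)) 0 0 = (γ : SL(2, ℤ)) 0 0 →
      (γ' : SL(2, ℤ)) 1 0 = -((γ : SL(2, ℤ)) 1 0) → χ γ' = χ γ
  have hP0 : P 0 := ⟨fun _ _ ↦ by simp, fun _ _ _ ↦ rfl, fun _ _ _ _ _ ↦ by simp⟩
  have hPadd : ∀ χ χ', P χ → P χ' → P (χ + χ') := by
    rintro χ χ' ⟨a, b, c⟩ ⟨a', b', c'⟩
    refine ⟨fun γ γ' ↦ ?_, fun γ γ' h ↦ ?_, fun p hp γ σ h ↦ ?_⟩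
    · simp only [Pi.add_apply, a, a']; abel
    · simp only [Pi.add_apply, b γ γ' h, b' γ γ' h]
    · simp only [Pi.add_apply, c p hp γ σ h, c' p hp γ σ h]; ring
  have hE0 : E 0 := fun _ _ _ _ ↦ rfl
  have hEadd : ∀ χ χ', E χ → E χ' → E (χ + χ') := fun χ χ' e e' γ γ' h00 h10 ↦ by
    simp only [Pi.add_apply, e γ γ' h00 h10, e' γ γ' h00 h10]
  have hex : ∃ χ₀, P χ₀ ∧ ¬ E χ₀ := by
    obtain ⟨χ₀, a, b, c, γ, γ', h00, h10, hne⟩ :=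
      exists_eigenChar_not_even_of_half_plusPeriod_not_mem f hf hQ A hA hrh
    exact ⟨χ₀, ⟨a, b, c⟩, fun e ↦ hne (e γ γ' h00 h10)⟩
  have h1 : χ₁ ≠ 0 := by obtain ⟨γ, hγ⟩ := n₁; exact fun h ↦ hγ (by simp [h])
  have h2 : χ₂ ≠ 0 := by obtain ⟨γ, hγ⟩ := n₂; exact fun h ↦ hγ (by simp [h])
  have heq := eq_of_card_le_four_of_exists_not_even P E hP0 hPadd hE0 hEadd (fun s hs ↦ hfour s hs) hex
    ⟨a₁, b₁, c₁⟩ e₁ ⟨a₂, b₂, c₂⟩ e₂ h1 h2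
  exact fun γ ↦ congrFun heq γ

end MultOne

/-! ## §3. The habitat⁺: FLAT at `(W, f)` with `hMO` replaced by (I) ∧ (II) -/

section Habitat

variable {W : WeierstrassCurve ℚ} [W.IsElliptic] [W.IsGloballyMinimal]

/-- **FLAT at `(W, f)` from «at most four mod-2 eigencharacters» (I), «`Ω⁺_f/2 ∉ Λ_f`» (II), an old family of a congruent
rational newform `g` of a divisor-type level `N₀` and ONE odd doubled plus symbol of `g`** — `…OldClassCongruence.flatAtTwo_of_multOne`
with its hypothesis `hMO` DISCHARGED by `multOnePlus_of_card_le_four`. For `W/ℚ` good supersingular at `2` with `a₂(W) = 0` and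
newform `f`: `2 ∤ L♭` for every Pollack pair `(L♯, L♭)` of `f` at `2`. Remaining displayed inputs: (I) `hfour` (the character count
behind Buzzard 2000 Prop. 2.4 — parts 2–3 of the dictionary), (II) `hrh`, the old family (`δ`, `H`, `hgood`, `hbad`), `hcongr`,
and the residual certificate `hres`. BSD is not proved by this. [cite: Buzzard2000, Prop. 2.4]
[cite: Pollack2003, Conj. 6.3 and Prop. 6.18] [cite: EmertonPollackWeston2006, §4.4] [cite: CremonaAlgorithms1997, §2.8] -/
theorem flatAtTwo_of_card_le_four [NeZero (W.conductorNorm ℤ)] {f : CuspForm (Gamma0 (W.conductorNorm ℤ)) 2}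
    (hf : IsNewformOf W f) (hss : GoodSS W 2) (ha : W.frobeniusTrace 2 = 0)
    (A : ℕ → ℤ) (hA : ∀ p : ℕ, p.Prime → cuspCoeff f p = (A p : ℂ))
    (hfour : ∀ s : Finset (Gamma0 (W.conductorNorm ℤ) → ZMod 2),
      (∀ χ ∈ s, (∀ γ γ' : Gamma0 (W.conductorNorm ℤ), χ (γ * γ') = χ γ + χ γ') ∧
        (∀ γ γ' : Gamma0 (W.conductorNorm ℤ),
          periodFunctional (W.conductorNorm ℤ) γ = periodFunctional (W.conductorNorm ℤ) γ' → χ γ = χ γ') ∧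
        (∀ (p : ℕ) (hp : p.Prime) (γ σ : Gamma0 (W.conductorNorm ℤ)),
          periodFunctional (W.conductorNorm ℤ) σ =
            (haveI : NeZero p := ⟨hp.ne_zero⟩; heckeT (Gamma0 (W.conductorNorm ℤ)) 2 p).dualMap
              (periodFunctional (W.conductorNorm ℤ) γ) →
          χ σ = ((A p : ℤ) : ZMod 2) * χ γ)) → s.card ≤ 4)
    (hrh : ((plusPeriod f / 2 : ℝ) : ℂ) ∉ periodLattice f)
    {N₀ : ℕ} [NeZero N₀] (g : CuspForm (Gamma0 N₀) 2) (hg : IsNewform0 g) (hQg : coeffField g = ⊥)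
    (h2N₀ : ¬ 2 ∣ N₀) (B : ℕ → ℤ) (hB : ∀ p : ℕ, p.Prime → cuspCoeff g p = (B p : ℂ)) (haev : Even (B 2))
    (hcongr : ∀ p : ℕ, p.Prime → ¬ p ∣ W.conductorNorm ℤ → ((A p : ℤ) : ZMod 2) = ((B p : ℤ) : ZMod 2))
    (S : Finset ℕ) (hS : S.Nonempty) (hodd : ∀ t ∈ S, Odd t)
    (δ : ℕ → (Gamma0 (W.conductorNorm ℤ) →* Gamma0 N₀))
    (hδ00 : ∀ t ∈ S, ∀ γ : Gamma0 (W.conductorNorm ℤ), ((δ t γ : Gamma0 N₀) : SL(2, ℤ)) 0 0 = (γ : SL(2, ℤ)) 0 0)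
    (hδ01 : ∀ t ∈ S, ∀ γ : Gamma0 (W.conductorNorm ℤ),
      ((δ t γ : Gamma0 N₀) : SL(2, ℤ)) 0 1 = (t : ℤ) * (γ : SL(2, ℤ)) 0 1)
    (hδ10 : ∀ t ∈ S, ∀ γ : Gamma0 (W.conductorNorm ℤ),
      ((δ t γ : Gamma0 N₀) : SL(2, ℤ)) 1 0 = (γ : SL(2, ℤ)) 1 0 / t)
    (hδ11 : ∀ t ∈ S, ∀ γ : Gamma0 (W.conductorNorm ℤ), ((δ t γ : Gamma0 N₀) : SL(2, ℤ)) 1 1 = (γ : SL(2, ℤ)) 1 1)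
    (hδdvd : ∀ t ∈ S, ∀ γ : Gamma0 (W.conductorNorm ℤ), (t : ℤ) ∣ (γ : SL(2, ℤ)) 1 0)
    (H : CuspForm (Gamma0 (W.conductorNorm ℤ)) 2)
    (hH : ∀ γ : Gamma0 (W.conductorNorm ℤ), cuspSymbol H γ = ∑ t ∈ S, cuspSymbol g (δ t γ))
    (hgood : ∀ (p : ℕ) (hp : p.Prime), ¬ p ∣ W.conductorNorm ℤ →
      (haveI : NeZero p := ⟨hp.ne_zero⟩; heckeT (Gamma0 (W.conductorNorm ℤ)) 2 p) H = ((B p : ℤ) : ℂ) • H)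
    (hbad : ∀ (p : ℕ) (hp : p.Prime), p ∣ W.conductorNorm ℤ → ∀ γ σ : Gamma0 (W.conductorNorm ℤ),
      periodFunctional (W.conductorNorm ℤ) σ =
        (haveI : NeZero p := ⟨hp.ne_zero⟩; heckeT (Gamma0 (W.conductorNorm ℤ)) 2 p).dualMap
          (periodFunctional (W.conductorNorm ℤ) γ) →
      ∀ mσ mγ : ℤ, (cuspSymbol H σ).re = mσ * (plusPeriod g / 2) → (cuspSymbol H γ).re = mγ * (plusPeriod g / 2) →
        (mσ : ZMod 2) = ((A p : ℤ) : ZMod 2) * (mγ : ZMod 2))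
    (hres : ∃ k : ℕ, 1 ≤ k ∧ ∃ b : ℤ, Odd b ∧ ∃ m : ℤ, Odd m ∧
      ratPlusSymbol g ((b : ℚ) / 4 ^ k) = ratPlusSymbol g 0 + (m : ℚ) / 2) :
    ∀ Lplus Lminus : IwasawaAlgebra 2, IsPollackPair f 2 Lplus Lminus → ¬ PowerSeries.C (2 : ℤ_[2]) ∣ Lminus :=
  flatAtTwo_of_multOne hf hss ha A hA
    (multOnePlus_of_card_le_four f hf.1 hf.coeffField_eq_bot A hA hfour hrh)
    g hg hQg h2N₀ B hB haev hcongr S hS hodd δ hδ00 hδ01 hδ10 hδ11 hδdvd H hH hgood hbad hres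

end Habitat

end MultOneDictionary

end Summit.BirchSwinnertonDyer.BirchSwinnertonDyer.Theorems.SignedMuAtTwo

end
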